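import Mathlib
import Literature.NumberTheory.LFunctions.Zhang2022.RepairBedLenxModel
import HarnessLib

/-!
# Zhang (2022), rescue bed (D-0124 (3)) Tier S add-on LENX, MODEL side II: the two DIAGONAL closed forms of the
# continued calculus for the registered overhang pieces — `Re 𝔅_θ(φ_θ) = 8h³/(3π) + (44/15)πh⁵` (arch) and
# `Re 𝔅_θ(v_J) = 8h/π + (52/3)πh³` (jump), `h = θ − 1` — hence `m_K*(v_A,θ)`, `m_K*(v_J,θ)` as tree closed forms

Topic `Literature/NumberTheory/LFunctions/Zhang2022` (Landau–Siegel audit tree; verdict-neutral).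
Y. Zhang, *Discrete mean estimates and the Landau–Siegel zero*, arXiv:2211.02515v1 (2022) [Zhang2022LandauSiegel] —
**an unrefereed manuscript under adjudication; nothing here asserts or denies any of its claims, and nothing here is
a claim about Landau–Siegel zeros.**

Companion of `RepairBedLenxModel` (classes, masses, cross values, `uKThreshold`). Bed-3's u_K word (spec bed3-addons
v0.2.6 clause (2)) compares the genuine `κ_K`-scaled uu entry with `m_K*(v,θ) = ‖model_uv(u_K,v,θ)‖²/Re 𝔅_θ(v)`; the
numerator is `RepairBedLenxModel.crossModel_gStar_archProfile/jumpProfile`, and this file supplies the denominator: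
the continued diagonal form `𝔅_θ(v) = M_θ(v,v) + conj M_θ(v,v)` (`Repair.topDiagForm`, `Repair.MformTop`,
`Repair.dipoleIntegrandTop`; weights `W = (½,2,3/2)`, `S_j = Repair.bS j = (5,4,3)`, `N_j = Repair.bN j = (6,3,2)`)
evaluated in closed form on the two registered pieces, by the template of `KnifeEdge.MformTop_plateau`:

* `tail_jumpProfile` (`∫_y^θ v_J = (θ−y)²/2`), `integral_dipoleIntegrandTop_jumpProfile` (per-`j` summand
  `h + iπ(S_j−j)h²/2 + π²(jS_j − N_j/2)h³/3 + iπ³jN_jh⁴/8`), **`MformTop_jumpProfile`**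
  (`M_θ(v_J,v_J) = 4h/π + 26πh³/3 + i(3h² + 3π²h⁴)`), **`topDiagForm_jumpProfile_re`** (`Re 𝔅_θ(v_J) = 8h/π + (52/3)πh³`);
* `tail_phiT` (`∫_y^θ φ_θ = h³/6 − h(y−1)²/2 + (y−1)³/3`), `integral_dipoleIntegrandTop_phiT` (per-`j` summand
  `h³/3 + π²(N_j + jS_j)h⁵/30 + iπ³jN_jh⁶/72` — the cross integral `∫φ′·tail = ∫φ²` equalises the two coefficients),
  **`MformTop_phiT`** (`M_θ(φ_θ,φ_θ) = 4h³/(3π) + (22/15)πh⁵ + iπ²h⁶/3`), **`topDiagForm_phiT_re`**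
  (`Re 𝔅_θ(φ_θ) = 8h³/(3π) + (44/15)πh⁵`; by `profBlockB_archProfile_eq_phiT` this is the arch's);
* `uKThreshold_arch_closed` (`m_K*(v_A,θ) = 16π²h⁶/(8h³/(3π) + 44πh⁵/15)`), `uKThreshold_jump_closed`
  (`m_K*(v_J,θ) = 144π²h⁴/(8h/π + 52πh³/3)`), `topDiagForm_re_pos_arch_jump` (both denominators `> 0` for `θ > 1`).

These reproduce ls-rescue-ref-1's hand derivation R1-B21 (`ΣW = 4`, `ΣWN = 12`, `ΣW·jS = 32`; three numeric lineages
agreed to ≤ 2.8e-15) as kernel theorems. Caveat as in the kit: `M_θ`, `θ > 1`, is formula I's calculus continued past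
`P`, not a proved main term; nothing here evaluates a genuine block or touches a registered word. Theorems only.

## References

* Y. Zhang, arXiv:2211.02515v1 (2022), §7 Prop 7.1, (7.2) p.44; §8 (8.11)–(8.12). [cite: Zhang2022LandauSiegel, §§7, 8]
-/

noncomputable section

open Complex Real ComplexConjugate Set intervalIntegral
open _root_.MeasureTheory

namespace Literature.NumberTheory.LFunctions.Zhang2022.Repair.Bed

open KnifeEdge

section ClosedForms

variable {θ : ℝ}

/-- `d/dw (w^{k+1}/(k+1)) = w^k`, cast to `ℂ`. [folklore] -/
private theorem hasDerivAt_ofReal_pow_succ_div (k : ℕ) (w : ℝ) :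
    HasDerivAt (fun w : ℝ => (((w ^ (k + 1) / ((k : ℝ) + 1) : ℝ)) : ℂ)) (((w ^ k : ℝ)) : ℂ) w := by
  have h := ((hasDerivAt_pow (k + 1) w).div_const ((k : ℝ) + 1)).ofReal_comp
  refine h.congr_deriv ?_
  have hk : ((k : ℝ) + 1) ≠ 0 := by positivity
  rw [Nat.add_sub_cancel]
  push_cast
  field_simp

/-- `∫₀^h (A₀ + A₁w + A₂w² + A₃w³ + A₄w⁴ + A₅w⁵) dw` for complex coefficients. [folklore] -/
private theorem integral_poly5 (A0 A1 A2 A3 A4 A5 : ℂ) (h : ℝ) :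
    ∫ w in (0:ℝ)..h, (A0 + A1 * (w : ℂ) + A2 * ((w ^ 2 : ℝ) : ℂ) + A3 * ((w ^ 3 : ℝ) : ℂ)
        + A4 * ((w ^ 4 : ℝ) : ℂ) + A5 * ((w ^ 5 : ℝ) : ℂ))
      = A0 * h + A1 * ((h ^ 2 / 2 : ℝ) : ℂ) + A2 * ((h ^ 3 / 3 : ℝ) : ℂ) + A3 * ((h ^ 4 / 4 : ℝ) : ℂ)
        + A4 * ((h ^ 5 / 5 : ℝ) : ℂ) + A5 * ((h ^ 6 / 6 : ℝ) : ℂ) := by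
  set G : ℝ → ℂ := fun w => A0 * (((w ^ (0 + 1) / ((0:ℕ) + 1 : ℝ) : ℝ)) : ℂ)
    + A1 * (((w ^ (1 + 1) / ((1:ℕ) + 1 : ℝ) : ℝ)) : ℂ) + A2 * (((w ^ (2 + 1) / ((2:ℕ) + 1 : ℝ) : ℝ)) : ℂ)
    + A3 * (((w ^ (3 + 1) / ((3:ℕ) + 1 : ℝ) : ℝ)) : ℂ) + A4 * (((w ^ (4 + 1) / ((4:ℕ) + 1 : ℝ) : ℝ)) : ℂ)
    + A5 * (((w ^ (5 + 1) / ((5:ℕ) + 1 : ℝ) : ℝ)) : ℂ) with hG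
  have hGd : ∀ w, HasDerivAt G (A0 * ((w ^ 0 : ℝ) : ℂ) + A1 * ((w ^ 1 : ℝ) : ℂ) + A2 * ((w ^ 2 : ℝ) : ℂ)
      + A3 * ((w ^ 3 : ℝ) : ℂ) + A4 * ((w ^ 4 : ℝ) : ℂ) + A5 * ((w ^ 5 : ℝ) : ℂ)) w := fun w =>
    ((((((hasDerivAt_ofReal_pow_succ_div 0 w).const_mul A0).add
      ((hasDerivAt_ofReal_pow_succ_div 1 w).const_mul A1)).add
      ((hasDerivAt_ofReal_pow_succ_div 2 w).const_mul A2)).add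
      ((hasDerivAt_ofReal_pow_succ_div 3 w).const_mul A3)).add
      ((hasDerivAt_ofReal_pow_succ_div 4 w).const_mul A4)).add
      ((hasDerivAt_ofReal_pow_succ_div 5 w).const_mul A5)
  have hEq : ∀ w : ℝ, A0 + A1 * (w : ℂ) + A2 * ((w ^ 2 : ℝ) : ℂ) + A3 * ((w ^ 3 : ℝ) : ℂ)
      + A4 * ((w ^ 4 : ℝ) : ℂ) + A5 * ((w ^ 5 : ℝ) : ℂ)
      = A0 * ((w ^ 0 : ℝ) : ℂ) + A1 * ((w ^ 1 : ℝ) : ℂ) + A2 * ((w ^ 2 : ℝ) : ℂ)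
      + A3 * ((w ^ 3 : ℝ) : ℂ) + A4 * ((w ^ 4 : ℝ) : ℂ) + A5 * ((w ^ 5 : ℝ) : ℂ) := fun w => by
    push_cast; ring
  simp_rw [hEq]
  rw [intervalIntegral.integral_eq_sub_of_hasDerivAt (fun w _ => hGd w)
    (Continuous.intervalIntegrable (by fun_prop) _ _)]
  simp only [hG]
  push_cast
  ring

/-- Tail of the jump from inside: `∫_y^θ v_J = (θ−y)²/2` for `1 ≤ y ≤ θ`. [cite: Zhang2022LandauSiegel, §7 (7.2) p.44] -/
theorem tail_jumpProfile {y : ℝ} (hy : 1 ≤ y) (hyθ : y ≤ θ) :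
    ∫ t in y..θ, jumpProfile θ t = ((((θ - y) ^ 2 / 2 : ℝ)) : ℂ) := by
  rw [intervalIntegral.integral_congr_Ioo_of_le hyθ (g := fun t => (((θ - t) : ℝ) : ℂ))
    (fun t ht => jumpProfile_of_mem ⟨lt_of_le_of_lt hy ht.1, ht.2.le⟩), intervalIntegral.integral_ofReal,
    intervalIntegral.integral_sub intervalIntegrable_const intervalIntegral.intervalIntegrable_id,
    intervalIntegral.integral_const, integral_id, smul_eq_mul]
  push_cast
  ring

/-- One `j`-summand of `M_θ(v_J, v_J)`: `∫₀^θ D_j = h + iπ(S_j − j)h²/2 + π²(jS_j − N_j/2)h³/3 + iπ³jN_jh⁴/8`,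
`h = θ − 1`. [cite: Zhang2022LandauSiegel, Prop 7.1 p.44, (8.11)–(8.12)] -/
theorem integral_dipoleIntegrandTop_jumpProfile (hθ : 1 ≤ θ) (j : ℕ) :
    ∫ y in (0:ℝ)..θ, dipoleIntegrandTop θ j (jumpProfile θ) (jumpProfile' θ) (jumpProfile θ) (jumpProfile' θ) y
      = ((θ - 1 : ℝ) : ℂ) + I * ((π * (bS j - j) * ((θ - 1) ^ 2 / 2) : ℝ) : ℂ)
        + ((π ^ 2 * (j * bS j - bN j / 2) * ((θ - 1) ^ 3 / 3) : ℝ) : ℂ)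
        + I * ((π ^ 3 * j * bN j * ((θ - 1) ^ 4 / 8) : ℝ) : ℂ) := by
  set D := dipoleIntegrandTop θ j (jumpProfile θ) (jumpProfile' θ) (jumpProfile θ) (jumpProfile' θ) with hD
  -- below the wall the integrand vanishes
  have hEq1 : EqOn D (fun _ => (0:ℂ)) (uIoo 0 1) := by
    intro y hy
    rw [uIoo_of_le zero_le_one] at hy
    have h0 : jumpProfile θ y = 0 := jumpProfile_of_not_mem fun h => not_lt.2 h.1.le hy.2
    have h0' : jumpProfile' θ y = 0 := by rw [jumpProfile', if_neg (fun h => not_lt.2 h.1.le hy.2)]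
    simp only [hD, dipoleIntegrandTop, h0, h0']
    ring
  -- on `(1, θ)` it is a cubic polynomial in `w = θ − y`
  set P : ℝ → ℂ := fun w => 1 + (I * π * ((bS j - j : ℝ) : ℂ)) * (w : ℂ)
    + ((π ^ 2 * (j * bS j - bN j / 2) : ℝ) : ℂ) * ((w ^ 2 : ℝ) : ℂ)
    + (I * π ^ 3 * j * ((bN j : ℝ) : ℂ) / 2) * ((w ^ 3 : ℝ) : ℂ) + 0 * ((w ^ 4 : ℝ) : ℂ) + 0 * ((w ^ 5 : ℝ) : ℂ)
    with hP
  have hEq2 : EqOn D (fun y => P (θ - y)) (uIoo 1 θ) := by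
    intro y hy
    rw [uIoo_of_le hθ] at hy
    have h1 : jumpProfile θ y = (((θ - y) : ℝ) : ℂ) := jumpProfile_of_mem ⟨hy.1, hy.2.le⟩
    have h1' : jumpProfile' θ y = -1 := by rw [jumpProfile', if_pos ⟨hy.1, hy.2⟩]
    simp only [hD, dipoleIntegrandTop, h1, h1', tail_jumpProfile hy.1.le hy.2.le, hP, map_add, map_mul, map_neg,
      map_one, Complex.conj_I, Complex.conj_ofReal, map_pow]
    push_cast
    have hI : I * I = -1 := Complex.I_mul_I
    linear_combination (-(π : ℂ) ^ 2 * (j : ℂ) * ((bS j : ℝ) : ℂ) * ((θ : ℂ) - (y : ℂ)) ^ 2) * hI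
  have i1 : IntervalIntegrable D volume 0 1 := (intervalIntegrable_const (c := (0:ℂ))).congr_uIoo hEq1.symm
  have hPc : Continuous (fun y : ℝ => P (θ - y)) := by rw [hP]; fun_prop
  have i2 : IntervalIntegrable D volume 1 θ := (hPc.intervalIntegrable 1 θ).congr_uIoo hEq2.symm
  rw [← intervalIntegral.integral_add_adjacent_intervals i1 i2, intervalIntegral.integral_congr_uIoo hEq1,
    intervalIntegral.integral_zero, zero_add, intervalIntegral.integral_congr_uIoo hEq2,
    intervalIntegral.integral_comp_sub_left (fun w => P w) θ, sub_self, hP, integral_poly5]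
  push_cast
  ring

/-- **The jump's continued diagonal form**: `M_θ(v_J, v_J) = 4h/π + 26πh³/3 + i(3h² + 3π²h⁴)`, `h = θ − 1`
(`ΣW_j = 4`, `ΣW_j(S_j − j) = 6`, `ΣW_jjS_j = 32`, `ΣW_jN_j = 12`, `ΣW_jjN_j = 24`).
[cite: Zhang2022LandauSiegel, Prop 7.1 p.44, (8.11)–(8.12)] -/
theorem MformTop_jumpProfile (hθ : 1 ≤ θ) :
    MformTop θ (jumpProfile θ) (jumpProfile' θ) (jumpProfile θ) (jumpProfile' θ)
      = ((4 * (θ - 1) / π + 26 * π * (θ - 1) ^ 3 / 3 : ℝ) : ℂ)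
        + I * ((3 * (θ - 1) ^ 2 + 3 * π ^ 2 * (θ - 1) ^ 4 : ℝ) : ℂ) := by
  unfold MformTop
  rw [integral_dipoleIntegrandTop_jumpProfile hθ 1, integral_dipoleIntegrandTop_jumpProfile hθ 2,
    integral_dipoleIntegrandTop_jumpProfile hθ 3, bN_one, bN_two, bN_three, bS_one, bS_two, bS_three]
  have hπ : (π : ℂ) ≠ 0 := by exact_mod_cast Real.pi_ne_zero
  push_cast
  field_simp
  ring

/-- **`Re 𝔅_θ(v_J) = 8h/π + (52/3)πh³`**, `h = θ − 1` (ref-1 R1-B21's closed form, three numeric lineages agree to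
2.8e-15; here a theorem of the continued calculus). [cite: Zhang2022LandauSiegel, Prop 7.1 p.44, (8.11)–(8.12)] -/
theorem topDiagForm_jumpProfile_re (hθ : 1 ≤ θ) :
    (topDiagForm θ (jumpProfile θ) (jumpProfile' θ)).re = 8 * (θ - 1) / π + 52 / 3 * π * (θ - 1) ^ 3 := by
  rw [topDiagForm_re, MformTop_jumpProfile hθ, Complex.add_re, Complex.ofReal_re, Complex.I_mul_re,
    Complex.ofReal_im]
  ring

/-- Tail of `φ_θ` from inside: `∫_y^θ φ_θ = h³/6 − h(y−1)²/2 + (y−1)³/3` for `1 ≤ y ≤ θ`, `h = θ − 1`.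
[cite: Zhang2022LandauSiegel, §7 (7.2) p.44] -/
theorem tail_phiT {y : ℝ} (hy : 1 ≤ y) (hyθ : y ≤ θ) :
    ∫ t in y..θ, phiT θ t
      = ((((θ - 1) ^ 3 / 6 - (θ - 1) * (y - 1) ^ 2 / 2 + (y - 1) ^ 3 / 3 : ℝ)) : ℂ) := by
  have e : ∫ t in y..θ, phiT θ t = ∫ t in y..θ, (((t - 1) * (θ - t) : ℝ) : ℂ) := by
    refine intervalIntegral.integral_congr fun t ht => ?_
    rw [uIcc_of_le hyθ] at ht
    exact phiT_of_ge (hy.trans ht.1)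
  have hF : ∀ t ∈ uIcc y θ, HasDerivAt (fun t : ℝ => (θ + 1) * (t * t) / 2 - θ * t - t * t * t / 3)
      ((t - 1) * (θ - t)) t := by
    intro t _
    have h2 : HasDerivAt (fun y : ℝ => y * y) (1 * t + t * 1) t := (hasDerivAt_id' t).mul (hasDerivAt_id' t)
    have h3 : HasDerivAt (fun y : ℝ => y * y * y) ((1 * t + t * 1) * t + t * t * 1) t :=
      h2.mul (hasDerivAt_id' t)
    have h := (((h2.const_mul (θ + 1)).div_const 2).sub ((hasDerivAt_id' t).const_mul θ)).sub
      (h3.div_const 3)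
    refine h.congr_deriv ?_
    ring
  rw [e, intervalIntegral.integral_ofReal, intervalIntegral.integral_eq_sub_of_hasDerivAt hF
    ((Continuous.intervalIntegrable (by fun_prop) (μ := volume) _ _))]
  push_cast
  ring

/-- One `j`-summand of `M_θ(φ_θ, φ_θ)`: `∫₀^θ D_j = h³/3 + π²(N_j + jS_j)h⁵/30 + iπ³jN_jh⁶/72`, `h = θ − 1`
(the cross integral `∫ φ′·tail = ∫ φ²` makes the `N_j` and `jS_j` coefficients equal).
[cite: Zhang2022LandauSiegel, Prop 7.1 p.44, (8.11)–(8.12)] -/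
theorem integral_dipoleIntegrandTop_phiT (hθ : 1 ≤ θ) (j : ℕ) :
    ∫ y in (0:ℝ)..θ, dipoleIntegrandTop θ j (phiT θ) (phiT' θ) (phiT θ) (phiT' θ) y
      = (((θ - 1) ^ 3 / 3 : ℝ) : ℂ) + ((π ^ 2 * (bN j + j * bS j) * ((θ - 1) ^ 5 / 30) : ℝ) : ℂ)
        + I * ((π ^ 3 * j * bN j * ((θ - 1) ^ 6 / 72) : ℝ) : ℂ) := by
  set D := dipoleIntegrandTop θ j (phiT θ) (phiT' θ) (phiT θ) (phiT' θ) with hD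
  have hEq1 : EqOn D (fun _ => (0:ℂ)) (uIoo 0 1) := by
    intro y hy
    rw [uIoo_of_le zero_le_one] at hy
    simp only [hD, dipoleIntegrandTop, phiT_of_le hy.2.le, phiT'_of_lt hy.2]
    ring
  -- on `(1, θ)` it is a quintic polynomial in `u = y − 1` (`h = θ − 1`)
  set h : ℝ := θ - 1 with hh
  set P : ℝ → ℂ := fun u =>
    ((h ^ 2 + π ^ 2 * bN j * h ^ 4 / 6 : ℝ) : ℂ)
    + (((-4 * h - π ^ 2 * bN j * h ^ 3 / 3 : ℝ) : ℂ)
        + I * ((π * (j - bS j) * h ^ 2 + π ^ 3 * j * bN j * h ^ 4 / 6 : ℝ) : ℂ)) * (u : ℂ)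
    + (((4 - π ^ 2 * bN j * h ^ 2 / 2 + π ^ 2 * j * bS j * h ^ 2 : ℝ) : ℂ)
        + I * ((-3 * π * (j - bS j) * h - π ^ 3 * j * bN j * h ^ 3 / 6 : ℝ) : ℂ)) * ((u ^ 2 : ℝ) : ℂ)
    + (((4 * π ^ 2 * bN j * h / 3 - 2 * π ^ 2 * j * bS j * h : ℝ) : ℂ)
        + I * ((2 * π * (j - bS j) - π ^ 3 * j * bN j * h ^ 2 / 2 : ℝ) : ℂ)) * ((u ^ 3 : ℝ) : ℂ)
    + (((-2 * π ^ 2 * bN j / 3 + π ^ 2 * j * bS j : ℝ) : ℂ)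
        + I * ((5 * π ^ 3 * j * bN j * h / 6 : ℝ) : ℂ)) * ((u ^ 4 : ℝ) : ℂ)
    + (I * ((-(π ^ 3 * j * bN j / 3) : ℝ) : ℂ)) * ((u ^ 5 : ℝ) : ℂ)
    with hP
  have hEq2 : EqOn D (fun y => P (y - 1)) (uIoo 1 θ) := by
    intro y hy
    rw [uIoo_of_le hθ] at hy
    simp only [hD, dipoleIntegrandTop, phiT_of_ge hy.1.le, phiT'_of_ge hy.1.le, tail_phiT hy.1.le hy.2.le, hP, hh,
      map_add, map_mul, Complex.conj_I, Complex.conj_ofReal, map_pow]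
    push_cast
    have hI : I * I = -1 := Complex.I_mul_I
    linear_combination (-(π : ℂ) ^ 2 * (j : ℂ) * ((bS j : ℝ) : ℂ) * (((y : ℂ) - 1) * ((θ : ℂ) - (y : ℂ))) ^ 2) * hI
  have i1 : IntervalIntegrable D volume 0 1 := (intervalIntegrable_const (c := (0:ℂ))).congr_uIoo hEq1.symm
  have hPc : Continuous (fun y : ℝ => P (y - 1)) := by rw [hP]; fun_prop
  have i2 : IntervalIntegrable D volume 1 θ := (hPc.intervalIntegrable 1 θ).congr_uIoo hEq2.symm
  rw [← intervalIntegral.integral_add_adjacent_intervals i1 i2, intervalIntegral.integral_congr_uIoo hEq1,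
    intervalIntegral.integral_zero, zero_add, intervalIntegral.integral_congr_uIoo hEq2,
    intervalIntegral.integral_comp_sub_right (fun w => P w) 1, sub_self, hP, integral_poly5]
  simp only [hh]
  push_cast
  ring

/-- **The arch's continued diagonal form**: `M_θ(φ_θ, φ_θ) = 4h³/(3π) + (22/15)πh⁵ + iπ²h⁶/3`, `h = θ − 1`
(`ΣW_j(N_j + jS_j) = 44`, `ΣW_jjN_j = 24`). [cite: Zhang2022LandauSiegel, Prop 7.1 p.44, (8.11)–(8.12)] -/
theorem MformTop_phiT (hθ : 1 ≤ θ) :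
    MformTop θ (phiT θ) (phiT' θ) (phiT θ) (phiT' θ)
      = ((4 * (θ - 1) ^ 3 / (3 * π) + 22 / 15 * π * (θ - 1) ^ 5 : ℝ) : ℂ)
        + I * ((π ^ 2 * (θ - 1) ^ 6 / 3 : ℝ) : ℂ) := by
  unfold MformTop
  rw [integral_dipoleIntegrandTop_phiT hθ 1, integral_dipoleIntegrandTop_phiT hθ 2,
    integral_dipoleIntegrandTop_phiT hθ 3, bN_one, bN_two, bN_three, bS_one, bS_two, bS_three]
  have hπ : (π : ℂ) ≠ 0 := by exact_mod_cast Real.pi_ne_zero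
  push_cast
  field_simp
  ring

/-- **`Re 𝔅_θ(φ_θ) = 8h³/(3π) + (44/15)πh⁵`**, `h = θ − 1` (ref-1 R1-B21's closed form; a theorem of the continued
calculus). With `profBlockB_archProfile_eq_phiT` this is `Re 𝔅_θ(v_A)` of the bed's arch piece.
[cite: Zhang2022LandauSiegel, Prop 7.1 p.44, (8.11)–(8.12)] -/
theorem topDiagForm_phiT_re (hθ : 1 ≤ θ) :
    (topDiagForm θ (phiT θ) (phiT' θ)).re = 8 * (θ - 1) ^ 3 / (3 * π) + 44 / 15 * π * (θ - 1) ^ 5 := by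
  rw [topDiagForm_re, MformTop_phiT hθ, Complex.add_re, Complex.ofReal_re, Complex.I_mul_re, Complex.ofReal_im]
  ring

/-- **`m_K*(v_A, θ)` as a tree closed form**: `16π²h⁶ / (8h³/(3π) + (44/15)πh⁵)`, `h = θ − 1`.
[cite: Zhang2022LandauSiegel, §7 (7.2) p.44] -/
theorem uKThreshold_arch_closed (hθ : 1 ≤ θ) :
    uKThreshold (((4 * π * (θ - 1) ^ 3 : ℝ)) : ℂ) (topDiagForm θ (phiT θ) (phiT' θ)).re
      = 16 * π ^ 2 * (θ - 1) ^ 6 / (8 * (θ - 1) ^ 3 / (3 * π) + 44 / 15 * π * (θ - 1) ^ 5) := by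
  rw [uKThreshold_arch, topDiagForm_phiT_re hθ]

/-- **`m_K*(v_J, θ)` as a tree closed form**: `144π²h⁴ / (8h/π + (52/3)πh³)`, `h = θ − 1`.
[cite: Zhang2022LandauSiegel, §7 (7.2) p.44] -/
theorem uKThreshold_jump_closed (hθ : 1 ≤ θ) :
    uKThreshold (((12 * π * (θ - 1) ^ 2 : ℝ)) : ℂ) (topDiagForm θ (jumpProfile θ) (jumpProfile' θ)).re
      = 144 * π ^ 2 * (θ - 1) ^ 4 / (8 * (θ - 1) / π + 52 / 3 * π * (θ - 1) ^ 3) := by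
  rw [uKThreshold_jump, topDiagForm_jumpProfile_re hθ]

/-- Both diagonal model entries are POSITIVE for `θ > 1` (so `m_K*` is an honest quotient there, and the model
blocks `[[𝔅(u), c],[c̄, Re 𝔅_θ(v)]]` with `𝔅(u) > 0` are definite or not according to `‖c‖² ≶ 𝔅(u)·Re 𝔅_θ(v)`).
[cite: Zhang2022LandauSiegel, Prop 7.1 p.44, (8.11)–(8.12)] -/
theorem topDiagForm_re_pos_arch_jump (hθ : 1 < θ) :
    0 < (topDiagForm θ (phiT θ) (phiT' θ)).re ∧ 0 < (topDiagForm θ (jumpProfile θ) (jumpProfile' θ)).re := by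
  have h : 0 < θ - 1 := by linarith
  rw [topDiagForm_phiT_re hθ.le, topDiagForm_jumpProfile_re hθ.le]
  constructor <;> positivity

end ClosedForms

end Literature.NumberTheory.LFunctions.Zhang2022.Repair.Bed
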